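import Summits.AtomisticToContinuum.BoseEinsteinCondensation.Theorems.BECThomsonPrincipleGDTransferDefs
import Summits.AtomisticToContinuum.BoseEinsteinCondensation.Theorems.BECGroundStateSOSIRModeCounting

/-!
# Route `BECThomsonPrinciple`, crux `GDTransfer` (stmt-AtomisticToContinuum-9482), line `dyson-dressed-witness`:
# stub `stub_modeCounting` — Parseval + kinetic Chebyshev + Dyson's upper bound

The last, physics-free step of the line: `WindowBoundFor v → PeriodicBECFor v` for every repulsive
finite-range `v`.  If for every window parameter `M` the near-minimisers of the periodic energy carry at most
`K√ρ·N` particles in the non-zero window modes `0 < 2π‖p‖_∞/L ≤ M√ρ` (`WindowBoundFor v`), then at every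
small density the `δ_N`-near-minimisers on the torus of side `L_N = (N/ρ)^{1/3}` condense, `⟨Ψ, n₀Ψ⟩ ≥ N/2`
(`PeriodicBECFor v`).  Proof (template `Theorems.ModeCounting.condensate_ge_half` and
`Theorems.IRModeCounting_proof`):
* Parseval in the traced variable `∑_p n_p = N` (`PeriodicTrialState.tsum_cellOccupation_planeWaveMode`) and
  for the gradient `∑_p |2πp/L|² n_p = ∫|∇Ψ|² ≤ E(Ψ)` (`tsum_fracDispersion_two_mul_cellOccupation`);
* Dyson's upper bound `E₀^per ≤ 4πρ₁a(1 + C₁a/b)N ≤ AρN`, `A = 4πa(1 + C₁c₁)`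
  (`LSSY2005_upperBound_periodic_holds`; it also discharges the finiteness hypothesis `E₀^per ≠ ⊤` of
  `WindowBoundFor`), so with `M = 2√(A+1)` (`M² = 4(A+1)`) and slack `δ ≤ ρN` the modes OFF the window
  (`|2πp/L|² ≥ 4π²‖p‖_∞²/L² > M²ρ`) carry at most `(A+1)ρN/(M²ρ) = N/4` particles (kinetic Chebyshev);
* the window carries at most `K√ρN ≤ N/4` particles once `√ρ ≤ 1/(4K)`;
* hence `n₀ ≥ N − N/4 − N/4 = N/2` (`condensate_ge_half_of_windowSum`, the counting step with a window SUM).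

References: LSSY2005 Thm. 2.2 (2.14) and §1.2 (1.17)–(1.19); KennedyLiebShastry1988 (IR bound ⇒ LRO).
-/

noncomputable section

open MeasureTheory Filter
open scoped ENNReal NNReal

namespace Summit.AtomisticToContinuum.BoseEinsteinCondensation.Cruxes.GDTransfer.DysonDressedWitness

open Literature.MathematicalPhysics.QuantumManyBody.BoseGas
open Summit.AtomisticToContinuum.BoseEinsteinCondensation.Theorems.GaussianDominationCan.Negative (InWindow)
open Summit.AtomisticToContinuum.BoseEinsteinCondensation.Theorems.ModeCounting (norm_sq_le_sum_sq)

/-- **Mode counting on the torus with a window sum** (aggregate form of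
`Theorems.ModeCounting.condensate_ge_half`).  Let `Ψ` be a periodic `N = m+1`-body state on the torus of
side `L` with plane-wave occupations `n_p`.  Suppose (window) `∑_{p ≠ 0, p ∈ window(M)} n_p ≤ N/4`;
(UV) `D ≤ |2πp/L|²` for every non-zero `p` off the window, with (tail) `D⁻¹⟨Ψ,HΨ⟩ ≤ N/4`.  Then
`⟨Ψ, n₀Ψ⟩ ≥ N/2`: pointwise `n_p ≤ [p = 0] n_p + 1_{window}(p) n_p + D⁻¹|2πp/L|² n_p`, summed with
Parseval `∑_p n_p = N` and `∑_p |2πp/L|² n_p = ∫|∇Ψ|² ≤ ⟨Ψ,HΨ⟩`. [cite: LSSY2005, §1.2 (1.17)–(1.19)] -/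
theorem condensate_ge_half_of_windowSum {m : ℕ} {L M : ℝ} (hL : 0 < L) (v : ℝ → ℝ≥0∞)
    (Ψ : PeriodicTrialState (m + 1) L) {D : ℝ≥0∞} (hD0 : D ≠ 0) (hDtop : D ≠ ⊤)
    (hWin : windowSum M m L (fun p => cellOccupation (m + 1) L (planeWaveMode L p) Ψ.ψ) ≤
      ENNReal.ofReal (((m + 1 : ℕ) : ℝ) / 4))
    (hUV : ∀ p : Fin 3 → ℤ, p ≠ 0 → ¬ InWindow M m L p → D ≤ fracDispersion 2 L p)
    (hT : D⁻¹ * periodicEnergy v Ψ ≤ ENNReal.ofReal (((m + 1 : ℕ) : ℝ) / 4)) :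
    ENNReal.ofReal (1 / 2 * ((m + 1 : ℕ) : ℝ)) ≤ condensateOccupation (m + 1) L Ψ.ψ := by
  classical
  set n : (Fin 3 → ℤ) → ℝ≥0∞ := fun k => cellOccupation (m + 1) L (planeWaveMode L k) Ψ.ψ with hn
  set W : Set (Fin 3 → ℤ) := {p | p ≠ 0 ∧ InWindow M m L p} with hW
  have hWin' : ∑' k, W.indicator n k ≤ ENNReal.ofReal (((m + 1 : ℕ) : ℝ) / 4) := hWin
  -- pointwise three-way bound: zero mode / window / ultraviolet tail
  have hpt : ∀ k, n k ≤ (if k = 0 then n k else 0) + W.indicator n k +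
      D⁻¹ * (fracDispersion 2 L k * n k) := by
    intro k
    by_cases hk0 : k = 0
    · rw [if_pos hk0]
      exact le_add_right (le_add_right le_rfl)
    · by_cases hkW : InWindow M m L k
      · rw [if_neg hk0, Set.indicator_of_mem (show k ∈ W from ⟨hk0, hkW⟩), zero_add]
        exact le_add_right le_rfl
      · refine le_add_left ?_
        calc n k = D⁻¹ * D * n k := by rw [ENNReal.inv_mul_cancel hD0 hDtop, one_mul]
          _ ≤ D⁻¹ * fracDispersion 2 L k * n k := by gcongr; exact hUV k hk0 hkW
          _ = D⁻¹ * (fracDispersion 2 L k * n k) := mul_assoc _ _ _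
  -- the ultraviolet tail carries at most `N/4`
  have hTsum : D⁻¹ * ∑' k, fracDispersion 2 L k * n k ≤ ENNReal.ofReal (((m + 1 : ℕ) : ℝ) / 4) := by
    refine le_trans ?_ hT
    gcongr
    calc ∑' k, fracDispersion 2 L k * n k = ∫⁻ X in cellN (m + 1) L, kineticDensity Ψ.ψ X :=
          tsum_fracDispersion_two_mul_cellOccupation hL Ψ
      _ ≤ periodicEnergy v Ψ := lintegral_mono fun X => le_self_add
  -- Parseval and summation of the pointwise bound
  have hsum : ((m + 1 : ℕ) : ℝ≥0∞) ≤
      n 0 + ENNReal.ofReal (((m + 1 : ℕ) : ℝ) / 4) + ENNReal.ofReal (((m + 1 : ℕ) : ℝ) / 4) := by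
    calc ((m + 1 : ℕ) : ℝ≥0∞) = ∑' k, n k := (Ψ.tsum_cellOccupation_planeWaveMode hL).symm
      _ ≤ ∑' k, ((if k = 0 then n k else 0) + W.indicator n k +
          D⁻¹ * (fracDispersion 2 L k * n k)) := ENNReal.tsum_le_tsum hpt
      _ = n 0 + (∑' k, W.indicator n k) + D⁻¹ * ∑' k, fracDispersion 2 L k * n k := by
          rw [ENNReal.tsum_add, ENNReal.tsum_add, tsum_ite_eq 0 n, ENNReal.tsum_mul_left]
      _ ≤ n 0 + ENNReal.ofReal (((m + 1 : ℕ) : ℝ) / 4) + ENNReal.ofReal (((m + 1 : ℕ) : ℝ) / 4) :=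
          add_le_add (add_le_add le_rfl hWin') hTsum
  -- conclusion: `N/2 + N/2 ≤ n₀ + N/2`
  have h2 : ENNReal.ofReal (1 / 2 * ((m + 1 : ℕ) : ℝ)) + ENNReal.ofReal (1 / 2 * ((m + 1 : ℕ) : ℝ)) =
      ((m + 1 : ℕ) : ℝ≥0∞) := by
    rw [← ENNReal.ofReal_add (by positivity) (by positivity), ← ENNReal.ofReal_natCast]
    exact congrArg ENNReal.ofReal (by ring)
  have h4 : ENNReal.ofReal (((m + 1 : ℕ) : ℝ) / 4) + ENNReal.ofReal (((m + 1 : ℕ) : ℝ) / 4) =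
      ENNReal.ofReal (1 / 2 * ((m + 1 : ℕ) : ℝ)) := by
    rw [← ENNReal.ofReal_add (by positivity) (by positivity)]
    exact congrArg ENNReal.ofReal (by ring)
  have hhalf : ENNReal.ofReal (1 / 2 * ((m + 1 : ℕ) : ℝ)) + ENNReal.ofReal (1 / 2 * ((m + 1 : ℕ) : ℝ)) ≤
      n 0 + ENNReal.ofReal (1 / 2 * ((m + 1 : ℕ) : ℝ)) := by
    rw [h2, ← h4, ← add_assoc]
    exact hsum
  have h0 : n 0 = condensateOccupation (m + 1) L Ψ.ψ := cellOccupation_planeWaveMode_zero (m + 1) L Ψ.ψ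
  rw [← h0]
  exact ENNReal.le_of_add_le_add_right ENNReal.ofReal_ne_top hhalf

/-- **Registered stub `stub_modeCounting`** (line `dyson-dressed-witness` of crux `GDTransfer`,
stmt-AtomisticToContinuum-9482): `WindowBoundFor v → PeriodicBECFor v` for every repulsive finite-range `v`.
Constants: `a = scatteringLength v < ∞`, `A = 4πa(1 + C₁c₁)` from LSSY Thm. 2.2 (so `E₀^per ≤ AρN` for
`ρ` below `3(c₁/(a+1))³/4π`, eventually in `N`), window parameter `M = 2√(A+1)`, the constants `ρ₁, K, N₁`
of `WindowBoundFor v` at `M`, `ρ₀ = min ρ₁ (min (3(c₁/(a+1))³/4π) (1/(4K))²)`, `c = 1/2`,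
`δ_N = min δ_W (ofReal (ρN))`. [cite: LSSY2005, Thm. 2.2 (2.14) and §1.2 (1.17)–(1.19)] -/
theorem stub_modeCounting : Sig.stub_modeCounting := by
  intro v hv hW
  -- constants attached to `v`: range, scattering length, the LSSY upper bound
  obtain ⟨R, hR, hvR⟩ := hv.exists_pos_range
  obtain ⟨C₁, c₁, hC₁, hc₁, hLSSY⟩ :=
    LSSY2005_upperBound_periodic_holds v R hv.1 hvR hv.scatteringLength_ne_top
  set a : ℝ := (scatteringLength v).toReal with ha
  have ha0 : 0 ≤ a := ENNReal.toReal_nonneg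
  set A : ℝ := 4 * Real.pi * a * (1 + C₁ * c₁) with hA
  have hA0 : 0 ≤ A := by positivity
  -- the window parameter `M = 2√(A+1)`, `M² = 4(A+1)`
  set M : ℝ := 2 * Real.sqrt (A + 1) with hM
  have hM0 : 0 < M := by positivity
  have hM2 : M ^ 2 = 4 * (A + 1) := by
    rw [hM, mul_pow, Real.sq_sqrt (by positivity)]
    norm_num
  obtain ⟨ρ₁, K, hρ₁, hK, N₁, hWin⟩ := hW M hM0
  -- density thresholds
  set ρa : ℝ := 3 * (c₁ / (a + 1)) ^ 3 / (4 * Real.pi) with hρa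
  have hρa0 : 0 < ρa := by positivity
  set ρK : ℝ := (1 / (4 * K)) ^ 2 with hρK
  have hρK0 : 0 < ρK := by positivity
  refine ⟨min ρ₁ (min ρa ρK), lt_min hρ₁ (lt_min hρa0 hρK0), fun ρ hρ hρ₀ => ?_⟩
  have hρ1' : ρ < ρ₁ := lt_of_lt_of_le hρ₀ (min_le_left _ _)
  have hρa' : ρ < ρa := lt_of_lt_of_le hρ₀ ((min_le_right _ _).trans (min_le_left _ _))
  have hρK' : ρ < ρK := lt_of_lt_of_le hρ₀ ((min_le_right _ _).trans (min_le_right _ _))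
  -- consequences of the thresholds
  have hsmall : (a + 1) * (4 * Real.pi * ρ / 3) ^ ((1 : ℝ) / 3) < c₁ := by
    have h1 : 4 * Real.pi * ρ / 3 < (c₁ / (a + 1)) ^ 3 := by
      rw [hρa, lt_div_iff₀ (by positivity)] at hρa'
      rw [div_lt_iff₀ (by norm_num : (0 : ℝ) < 3)]
      linarith
    have h2 : (4 * Real.pi * ρ / 3) ^ ((1 : ℝ) / 3) < c₁ / (a + 1) := by
      calc (4 * Real.pi * ρ / 3) ^ ((1 : ℝ) / 3) < ((c₁ / (a + 1)) ^ 3) ^ ((1 : ℝ) / 3) :=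
            Real.rpow_lt_rpow (by positivity) h1 (by norm_num)
        _ = c₁ / (a + 1) := by
            rw [show ((1 : ℝ) / 3) = ((3 : ℕ) : ℝ)⁻¹ by norm_num,
              Real.pow_rpow_inv_natCast (by positivity) (by norm_num)]
    calc (a + 1) * (4 * Real.pi * ρ / 3) ^ ((1 : ℝ) / 3) < (a + 1) * (c₁ / (a + 1)) := by
          gcongr
      _ = c₁ := by field_simp
  have hsqrtρ : 4 * K * Real.sqrt ρ ≤ 1 := by
    have h1 : Real.sqrt ρ < 1 / (4 * K) := by
      calc Real.sqrt ρ < Real.sqrt ρK := Real.sqrt_lt_sqrt hρ.le hρK'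
        _ = 1 / (4 * K) := by rw [hρK, Real.sqrt_sq (by positivity)]
    rw [lt_div_iff₀ (by positivity)] at h1
    linarith
  -- the answer: `c = 1/2`, eventually in `N`
  refine ⟨1 / 2, by norm_num, ?_⟩
  filter_upwards [eventually_ge_atTop N₁, eventually_ge_atTop 2,
    (tendsto_sideLength_atTop hρ).eventually_gt_atTop (2 * R)] with N hN1 hN2 hRL
  -- write `N = m + 1`
  obtain ⟨m, rfl⟩ : ∃ m, N = m + 1 := ⟨N - 1, by omega⟩
  have hN : 0 < m + 1 := Nat.succ_pos m
  have hNr : (0 : ℝ) < ((m + 1 : ℕ) : ℝ) := Nat.cast_pos.2 hN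
  set L : ℝ := sideLength ρ (m + 1) with hLdef
  have hL : 0 < L := Real.rpow_pos_of_pos (div_pos hNr hρ) _
  have hL3 : ρ * L ^ 3 = ((m + 1 : ℕ) : ℝ) := by
    rw [hLdef, sideLength_pow_three hρ (m + 1)]
    field_simp
  have hρL : ((m + 1 : ℕ) : ℝ) / L ^ 3 = ρ := div_sideLength_pow_three hρ hN
  -- Dyson's bound `E₀^per ≤ A ρ N` (LSSY Thm. 2.2 with `ρ_D = (N-1)/L³ ≤ ρ`, `a/b ≤ c₁`)
  have hE0 : periodicGroundStateEnergy v (m + 1) L ≤ ENNReal.ofReal (A * ρ * ((m + 1 : ℕ) : ℝ)) := by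
    have hL1 := hLSSY (m + 1) L hN2 hL hRL
    simp only [] at hL1
    set ρD : ℝ := ((((m + 1 : ℕ) : ℝ)) - 1) / L ^ 3 with hρD
    have hN2r : (2 : ℝ) ≤ ((m + 1 : ℕ) : ℝ) := by exact_mod_cast hN2
    have hρD0 : 0 ≤ ρD := div_nonneg (by linarith) (by positivity)
    have hρDρ : ρD ≤ ρ := by
      rw [hρD, div_le_iff₀ (by positivity), hL3]
      linarith
    have hx : a * (4 * Real.pi * ρD / 3) ^ ((1 : ℝ) / 3) ≤ c₁ := by
      have h1 : (4 * Real.pi * ρD / 3) ^ ((1 : ℝ) / 3) ≤ (4 * Real.pi * ρ / 3) ^ ((1 : ℝ) / 3) :=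
        Real.rpow_le_rpow (by positivity) (by gcongr) (by norm_num)
      calc a * (4 * Real.pi * ρD / 3) ^ ((1 : ℝ) / 3)
          ≤ (a + 1) * (4 * Real.pi * ρ / 3) ^ ((1 : ℝ) / 3) :=
            mul_le_mul (by linarith) h1 (by positivity) (by positivity)
        _ ≤ c₁ := hsmall.le
    have hL2 := hL1 (by rw [div_rpow_neg_third (by positivity)]; exact hx)
    rw [div_rpow_neg_third (by positivity)] at hL2
    refine hL2.trans (ENNReal.ofReal_le_ofReal ?_)
    rw [hA]
    calc 4 * Real.pi * ρD * a * (1 + C₁ * (a * (4 * Real.pi * ρD / 3) ^ ((1 : ℝ) / 3))) *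
          ((m + 1 : ℕ) : ℝ)
        ≤ 4 * Real.pi * ρ * a * (1 + C₁ * c₁) * ((m + 1 : ℕ) : ℝ) := by gcongr
      _ = 4 * Real.pi * a * (1 + C₁ * c₁) * ρ * ((m + 1 : ℕ) : ℝ) := by ring
  -- in particular `E₀^per < ∞`, and `N = ρL³ ≤ ρ₁L³`: the window bound applies
  have hE0top : periodicGroundStateEnergy v (m + 1) L ≠ ⊤ :=
    ne_top_of_le_ne_top ENNReal.ofReal_ne_top hE0
  have hNL : ((m + 1 : ℕ) : ℝ) ≤ ρ₁ * L ^ 3 := by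
    rw [← hL3]
    exact mul_le_mul_of_nonneg_right hρ1'.le (by positivity)
  obtain ⟨δW, hδW, hWΨ⟩ := hWin m hN1 L hL hNL hE0top
  -- the slack `δ_N = min(δ_W, ρN)`
  refine ⟨min δW (ENNReal.ofReal (ρ * ((m + 1 : ℕ) : ℝ))),
    lt_min hδW (ENNReal.ofReal_pos.2 (by positivity)), ?_⟩
  intro Ψ hΨ
  have hΨW : periodicEnergy v Ψ ≤ periodicGroundStateEnergy v (m + 1) L + δW :=
    hΨ.trans (add_le_add le_rfl (min_le_left _ _))
  have hΨE : periodicEnergy v Ψ ≤ ENNReal.ofReal ((A + 1) * ρ * ((m + 1 : ℕ) : ℝ)) := by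
    calc periodicEnergy v Ψ
        ≤ periodicGroundStateEnergy v (m + 1) L + ENNReal.ofReal (ρ * ((m + 1 : ℕ) : ℝ)) :=
          hΨ.trans (add_le_add le_rfl (min_le_right _ _))
      _ ≤ ENNReal.ofReal (A * ρ * ((m + 1 : ℕ) : ℝ)) + ENNReal.ofReal (ρ * ((m + 1 : ℕ) : ℝ)) :=
          add_le_add hE0 le_rfl
      _ = ENNReal.ofReal ((A + 1) * ρ * ((m + 1 : ℕ) : ℝ)) := by
          rw [← ENNReal.ofReal_add (by positivity) (by positivity)]
          exact congrArg ENNReal.ofReal (by ring)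
  -- the counting step with `D = M²ρ = 4(A+1)ρ`
  set D : ℝ≥0∞ := ENNReal.ofReal (4 * (A + 1) * ρ) with hD
  have hDpos : 0 < 4 * (A + 1) * ρ := by positivity
  have hD0 : D ≠ 0 := (ENNReal.ofReal_pos.2 hDpos).ne'
  refine condensate_ge_half_of_windowSum (M := M) hL v Ψ hD0 ENNReal.ofReal_ne_top ?_ ?_ ?_
  · -- (window) `K√ρ N ≤ N/4`
    refine (hWΨ Ψ hΨW).trans (ENNReal.ofReal_le_ofReal ?_)
    rw [hρL]
    have hm0 : (0 : ℝ) ≤ (m : ℝ) + 1 := by positivity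
    have h1 := mul_le_mul_of_nonneg_right hsqrtρ hm0
    push_cast
    linarith
  · -- (UV) off the window `4(A+1)ρ = M²ρ < |2πp/L|²` (`‖p‖_∞² ≤ |p|₂²`)
    intro p _ hpW
    have hlt : M * Real.sqrt (((m + 1 : ℕ) : ℝ) / L ^ 3) <
        2 * Real.pi * ‖(fun j => (p j : ℝ))‖ / L := not_le.mp hpW
    rw [hρL, lt_div_iff₀ hL] at hlt
    have key : 4 * (A + 1) * ρ * L ^ 2 < 4 * Real.pi ^ 2 * ‖(fun j => (p j : ℝ))‖ ^ 2 := by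
      calc 4 * (A + 1) * ρ * L ^ 2 = (M * Real.sqrt ρ * L) ^ 2 := by
            rw [mul_pow, mul_pow, Real.sq_sqrt hρ.le, hM2]
        _ < (2 * Real.pi * ‖(fun j => (p j : ℝ))‖) ^ 2 :=
            pow_lt_pow_left₀ hlt (by positivity) two_ne_zero
        _ = 4 * Real.pi ^ 2 * ‖(fun j => (p j : ℝ))‖ ^ 2 := by ring
    rw [hD, fracDispersion_two]
    refine ENNReal.ofReal_le_ofReal ?_
    rw [le_div_iff₀ (by positivity)]
    calc 4 * (A + 1) * ρ * L ^ 2 ≤ 4 * Real.pi ^ 2 * ‖(fun j => (p j : ℝ))‖ ^ 2 := key.le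
      _ ≤ 4 * Real.pi ^ 2 * ∑ j, (p j : ℝ) ^ 2 := by gcongr; exact norm_sq_le_sum_sq p
  · -- (tail) `(E₀ + δ)/(4(A+1)ρ) ≤ (A+1)ρN/(4(A+1)ρ) = N/4`
    calc D⁻¹ * periodicEnergy v Ψ ≤ D⁻¹ * ENNReal.ofReal ((A + 1) * ρ * ((m + 1 : ℕ) : ℝ)) := by
          gcongr
      _ = ENNReal.ofReal ((A + 1) * ρ * ((m + 1 : ℕ) : ℝ) / (4 * (A + 1) * ρ)) := by
          rw [← ENNReal.div_eq_inv_mul, hD, ← ENNReal.ofReal_div_of_pos hDpos]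
      _ = ENNReal.ofReal (((m + 1 : ℕ) : ℝ) / 4) := by
          congr 1
          field_simp

end Summit.AtomisticToContinuum.BoseEinsteinCondensation.Cruxes.GDTransfer.DysonDressedWitness

end
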